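import Summits.QuantumFields.YangMills.Theorems.F4SubCurvatureDoorPlanarFrames
import Literature.MathematicalPhysics.QuantumLattice.TorusSectorPropagatorConstants
import Mathlib
import HarnessLib

/-!
# LINE g20-A «angular type» — rung R1⁺ `PlanarConicChart` BY NAME (⟨stmt-QuantumFields-23035⟩)

Crux `F4SubCurvatureDoor.ShortRootRigidity` ⟨stmt-QuantumFields-23035⟩, registered skeleton `Cruxes/ShortRootRigidity/Lines/angular_type.lean`,
owner rung file `Cruxes/ShortRootRigidity/Lines/angular_type_rungs.lean` (ns `…AngularTypeRungs`, stamped by idea-crit-4).  This file restates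
R1⁺ `PlanarConicChart` CHARACTER-IDENTICALLY (`E2`, `InPlanarClass` the registered copies, `mk2` the by-name copy of
`…PlanarFrameTimeHolomorphyRegistered`) and PROVES `planarConicChart : PlanarConicChart`: at every `y ≠ 0` a hexagonal planar-class kernel
is the real trace of ONE function holomorphic on the complex polydisc of radius `c‖y‖` around `y` (one universal `c > 0` per kernel),
bounded there by ANY bound of `|k|` on `{‖y'‖ ≥ c‖y‖}` — the quantitative chart that step S2 (Lukacs, tube aperture) consumes.

PROOF.  `…PlanarFrames.exists_frameChart` (two frames with `|⟪y, n⟫| ≥ ‖y‖/2` by `exists_good_pair`, R0 transported by the `D₆` rotations,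
Siciak/Bernstein `Literature.Analysis.Complex.exists_holomorphic_extension_of_separately_local_fintype` at `ℓ = 1` with its universal radius
`r`) gives the chart `G` in the oblique frame coordinates `t` (`y' = y + L t₁ n₁ + L t₂ n₂`, `L = ‖y‖/6`) on the polydisc `|tᵢ| < r`, bounded by
the MAXIMUM of `|k|` on the annulus `‖y‖/4 ≤ ‖·‖ ≤ 2‖y‖` (attained at some `z₀`).  Pull back by the complex-affine inverse
`t = N⁻¹(w - y)/L` (`N = [n₁ n₂]`, `|det N| = √3/2`): the sup-ball of radius `c‖y‖`, `c = min(1/4, r√3/48)`, lands in the polydisc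
(`|tᵢ| ≤ 2c‖y‖/(L·√3/2) = 8√3 c ≤ r/2`), real points go to real points with `y + L t₁ n₁ + L t₂ n₂ = (a, b)`, and since `‖z₀‖ ≥ ‖y‖/4 ≥ c‖y‖`
the sharp bound `|k(z₀)|` is below every admissible `M`.

HONEST LABEL: R1⁺ is a rung of an OPEN line; nothing about the stubs (C) `PlanarSpectralCone` / (A) `AngularContinuation` /
`OddModeRigidity`, ⟨23035⟩, ⟨23125⟩, R2d or any summit is proved here; the Yang–Mills mass gap is NOT proved; no summit is proved by a line.
-/

noncomputable section

open MeasureTheory Filter Topology Set Metric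
open scoped BigOperators

namespace Summit.QuantumFields.YangMills.Theorems.F4SubCurvatureDoorPlanarConicChartRegistered

open Summit.QuantumFields.YangMills.Theorems.F4SubCurvatureDoorSliceDensityRegistered (E2)
open Summit.QuantumFields.YangMills.Theorems.F4SubCurvatureDoorSliceInClassRegistered (InPlanarClass)
open Summit.QuantumFields.YangMills.Theorems.F4SubCurvatureDoorPlanarLaplaceFourier
open Summit.QuantumFields.YangMills.Theorems.F4SubCurvatureDoorPlanarFrameTimeHolomorphyRegistered (mk2)
open Summit.QuantumFields.YangMills.Theorems.F4SubCurvatureDoorPlanarFrames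

/-- **R1⁺ · PlanarConicChart** (target, M; budget-free; the quantitative form S2 consumes).  There is `c > 0` (depending on
`k` only through nothing — in fact universal, but stated per `k`) such that at every `y ≠ 0` the kernel is, on the real points
of the complex polydisc of radius `c‖y‖` around `y`, the trace of a function holomorphic on that polydisc and bounded there by
ANY bound of `|k|` on `{y' : c‖y‖ ≤ ‖y'‖}`.  Plan: two frames with `|y · n_θ| ≥ ‖y‖/2` + R0 + Bernstein's local cross theorem
`Literature.Analysis.Complex.exists_holomorphic_extension_of_separately_three_local` + dilation.
[target; sources: JarnickiPflug2011 Ch. 5; Bernstein 1912] -/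
def PlanarConicChart : Prop :=
  ∀ k : E2 → ℝ, InPlanarClass k → ∃ c : ℝ, 0 < c ∧ ∀ y : E2, y ≠ 0 →
    ∃ F : ℂ × ℂ → ℂ,
      DifferentiableOn ℂ F (Metric.ball ((((y 0 : ℝ) : ℂ), ((y 1 : ℝ) : ℂ)) : ℂ × ℂ) (c * ‖y‖)) ∧
      (∀ a b : ℝ, |a - y 0| < c * ‖y‖ → |b - y 1| < c * ‖y‖ → F ((a : ℂ), (b : ℂ)) = k (mk2 a b)) ∧
      ∀ M : ℝ, (∀ y' : E2, c * ‖y‖ ≤ ‖y'‖ → |k y'| ≤ M) →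
        ∀ w ∈ Metric.ball ((((y 0 : ℝ) : ℂ), ((y 1 : ℝ) : ℂ)) : ℂ × ℂ) (c * ‖y‖), ‖F w‖ ≤ M

/-! ## The chart in standard coordinates, for one frame pair -/

/-- **The conic chart from two good frames.**  With the data of `…PlanarFrames.exists_frameChart`, `a₁b₂ - a₂b₁ ≠ 0`, `0 < c ≤ 1/4` and
`24c ≤ r·|a₁b₂ - a₂b₁|`: the chart of radius `c‖y‖` in the standard coordinates with the universal bound. -/
theorem conicChart_of_framePair {k : E2 → ℝ} (hk : InPlanarClass k) {y : E2} (hy : y ≠ 0)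
    (τ₁ τ₂ : E2 → ℝ) (a₁ b₁ a₂ b₂ : ℝ) (hn₁ : a₁ ^ 2 + b₁ ^ 2 = 1) (hn₂ : a₂ ^ 2 + b₂ ^ 2 = 1)
    (hτ₁ : ∀ q, τ₁ q = a₁ * q 0 + b₁ * q 1) (hτ₂ : ∀ q, τ₂ q = a₂ * q 0 + b₂ * q 1)
    (hdet : a₁ * b₂ - a₂ * b₁ ≠ 0) (hinner : |a₁ * a₂ + b₁ * b₂| ≤ 1 / 2)
    (hy₁ : ‖y‖ / 2 ≤ |τ₁ y|) (hy₂ : ‖y‖ / 2 ≤ |τ₂ y|)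
    (hF₁ : ∀ q : E2, τ₁ q ≠ 0 → ∃ g : ℂ → ℂ, DifferentiableOn ℂ g (ball (0 : ℂ) |τ₁ q|) ∧
        (∀ u : ℝ, |u| < |τ₁ q| → g u = k (mk2 (q 0 + u * a₁) (q 1 + u * b₁))) ∧
        ∀ w ∈ ball (0 : ℂ) |τ₁ q|, ‖g w‖ ≤ k (mk2 (τ₁ q + w.re) 0))
    (hF₂ : ∀ q : E2, τ₂ q ≠ 0 → ∃ g : ℂ → ℂ, DifferentiableOn ℂ g (ball (0 : ℂ) |τ₂ q|) ∧
        (∀ u : ℝ, |u| < |τ₂ q| → g u = k (mk2 (q 0 + u * a₂) (q 1 + u * b₂))) ∧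
        ∀ w ∈ ball (0 : ℂ) |τ₂ q|, ‖g w‖ ≤ k (mk2 (τ₂ q + w.re) 0))
    {r c : ℝ} (hcpos : 0 < c) (hc4 : c ≤ 1 / 4) (hcr : 24 * c ≤ r * |a₁ * b₂ - a₂ * b₁|)
    (hcross : ∀ (M : ℝ) (P : (Fin 2 → ℝ) → ℂ),
      (∀ x : Fin 2 → ℝ, (∀ i, |x i| < 1) → ‖P x‖ ≤ M) →
      (∀ (i : Fin 2) (x : Fin 2 → ℝ), (∀ j, |x j| < 1) → ∃ g : ℂ → ℂ,
        DifferentiableOn ℂ g (ball (0 : ℂ) 1) ∧ (∀ w ∈ ball (0 : ℂ) 1, ‖g w‖ ≤ M) ∧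
        ∀ t : ℝ, |t| < 1 → g t = P (Function.update x i t)) →
      ∃ G : (Fin 2 → ℂ) → ℂ,
        DifferentiableOn ℂ G {z : Fin 2 → ℂ | ∀ i, ‖z i‖ < r} ∧
        (∀ z : Fin 2 → ℂ, (∀ i, ‖z i‖ < r) → ‖G z‖ ≤ M) ∧
        ∀ x : Fin 2 → ℝ, (∀ i, |x i| < r) → G (fun i => (x i : ℂ)) = P x) :
    ∃ F : ℂ × ℂ → ℂ,
      DifferentiableOn ℂ F (Metric.ball ((((y 0 : ℝ) : ℂ), ((y 1 : ℝ) : ℂ)) : ℂ × ℂ) (c * ‖y‖)) ∧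
      (∀ a b : ℝ, |a - y 0| < c * ‖y‖ → |b - y 1| < c * ‖y‖ → F ((a : ℂ), (b : ℂ)) = k (mk2 a b)) ∧
      ∀ M : ℝ, (∀ y' : E2, c * ‖y‖ ≤ ‖y'‖ → |k y'| ≤ M) →
        ∀ w ∈ Metric.ball ((((y 0 : ℝ) : ℂ), ((y 1 : ℝ) : ℂ)) : ℂ × ℂ) (c * ‖y‖), ‖F w‖ ≤ M := by
  obtain ⟨z₀, hz₀, G, hGd, hGM, hGr⟩ :=
    exists_frameChart hk hy τ₁ τ₂ a₁ b₁ a₂ b₂ hn₁ hn₂ hτ₁ hτ₂ hinner hy₁ hy₂ hF₁ hF₂ hcross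
  have hy_pos : 0 < ‖y‖ := norm_pos_iff.2 hy
  obtain ⟨L, hL⟩ : ∃ L : ℝ, L = ‖y‖ / 6 := ⟨_, rfl⟩
  have hLpos : 0 < L := by rw [hL]; positivity
  obtain ⟨D, hD⟩ : ∃ D : ℝ, D = a₁ * b₂ - a₂ * b₁ := ⟨_, rfl⟩
  have hD0 : D ≠ 0 := by rw [hD]; exact hdet
  have hDpos : 0 < |D| := abs_pos.2 hD0
  have hrD : 12 * c / |D| ≤ r / 2 := by
    rw [div_le_iff₀ hDpos, hD]
    linarith
  have hrpos : 0 < r := by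
    have : 0 < 12 * c / |D| := by positivity
    linarith
  obtain ⟨ha₁, hb₁⟩ := Literature.MathematicalPhysics.QuantumLattice.abs_le_one_of_sq_add_sq hn₁
  obtain ⟨ha₂, hb₂⟩ := Literature.MathematicalPhysics.QuantumLattice.abs_le_one_of_sq_add_sq hn₂
  -- the complex-affine pull-back to the frame coordinates
  obtain ⟨T, hT⟩ : ∃ T : ℂ × ℂ → (Fin 2 → ℂ), T = fun w =>
      ![((b₂ : ℂ) * (w.1 - (y 0 : ℝ)) - (a₂ : ℂ) * (w.2 - (y 1 : ℝ))) / ((L : ℂ) * (D : ℂ)),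
        (-(b₁ : ℂ) * (w.1 - (y 0 : ℝ)) + (a₁ : ℂ) * (w.2 - (y 1 : ℝ))) / ((L : ℂ) * (D : ℂ))] := ⟨_, rfl⟩
  have hT0 : ∀ w, T w 0 = ((b₂ : ℂ) * (w.1 - (y 0 : ℝ)) - (a₂ : ℂ) * (w.2 - (y 1 : ℝ))) / ((L : ℂ) * (D : ℂ)) :=
    fun w => by rw [hT]; rfl
  have hT1 : ∀ w, T w 1 = (-(b₁ : ℂ) * (w.1 - (y 0 : ℝ)) + (a₁ : ℂ) * (w.2 - (y 1 : ℝ))) / ((L : ℂ) * (D : ℂ)) :=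
    fun w => by rw [hT]; rfl
  have hTdiff : Differentiable ℂ T := by
    rw [hT]
    refine differentiable_pi.2 fun i => ?_
    fin_cases i
    · simp only [Fin.zero_eta, Fin.isValue, Matrix.cons_val_zero]
      fun_prop
    · simp only [Fin.mk_one, Fin.isValue, Matrix.cons_val_one, Matrix.cons_val_fin_one]
      fun_prop
  -- size of the pull-back on the sup-ball
  have hLD : ‖(L : ℂ) * (D : ℂ)‖ = L * |D| := by
    rw [norm_mul, Complex.norm_real, Complex.norm_real, Real.norm_eq_abs, Real.norm_eq_abs, abs_of_pos hLpos]
  have hTbound : ∀ w : ℂ × ℂ, ‖w.1 - (y 0 : ℝ)‖ < c * ‖y‖ → ‖w.2 - (y 1 : ℝ)‖ < c * ‖y‖ → ∀ i, ‖T w i‖ < r := by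
    intro w h1 h2 i
    have hnum : ∀ (p q : ℝ) (u v : ℂ), |p| ≤ 1 → |q| ≤ 1 → ‖u‖ < c * ‖y‖ → ‖v‖ < c * ‖y‖ →
        ‖((p : ℂ) * u + (q : ℂ) * v) / ((L : ℂ) * (D : ℂ))‖ < r := by
      intro p q u v hp hq hu hv
      rw [norm_div, hLD, div_lt_iff₀ (by positivity)]
      have h3 : ‖(p : ℂ) * u + (q : ℂ) * v‖ ≤ ‖u‖ + ‖v‖ := by
        refine (norm_add_le _ _).trans ?_
        rw [norm_mul, norm_mul, Complex.norm_real, Complex.norm_real, Real.norm_eq_abs, Real.norm_eq_abs]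
        nlinarith [norm_nonneg u, norm_nonneg v]
      have h4 : 2 * (c * ‖y‖) ≤ r / 2 * (L * |D|) := by
        have := mul_le_mul_of_nonneg_right hrD (by positivity : 0 ≤ L * |D|)
        have e : 12 * c / |D| * (L * |D|) = 2 * (c * ‖y‖) := by
          rw [hL]; field_simp; ring
        rw [e] at this
        exact this
      nlinarith [mul_pos hLpos hDpos]
    revert i
    rw [Fin.forall_fin_two, hT0, hT1]
    constructor
    · have := hnum b₂ (-a₂) (w.1 - (y 0 : ℝ)) (w.2 - (y 1 : ℝ)) hb₂ (by rw [abs_neg]; exact ha₂) h1 h2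
      push_cast at this
      simpa [sub_eq_add_neg, neg_mul] using this
    · have := hnum (-b₁) a₁ (w.1 - (y 0 : ℝ)) (w.2 - (y 1 : ℝ)) (by rw [abs_neg]; exact hb₁) ha₁ h1 h2
      push_cast at this
      simpa [neg_mul] using this
  have hball : ∀ w : ℂ × ℂ, w ∈ ball ((((y 0 : ℝ) : ℂ), ((y 1 : ℝ) : ℂ)) : ℂ × ℂ) (c * ‖y‖) →
      ‖w.1 - (y 0 : ℝ)‖ < c * ‖y‖ ∧ ‖w.2 - (y 1 : ℝ)‖ < c * ‖y‖ := by
    intro w hw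
    rw [mem_ball, Prod.dist_eq, max_lt_iff, dist_eq_norm, dist_eq_norm] at hw
    exact hw
  refine ⟨fun w => G (T w), ?_, ?_, ?_⟩
  · -- holomorphy
    refine hGd.comp hTdiff.differentiableOn fun w hw => ?_
    obtain ⟨h1, h2⟩ := hball w hw
    exact hTbound w h1 h2
  · -- real points
    intro a b ha hb
    obtain ⟨t, htdef⟩ : ∃ t : Fin 2 → ℝ, t = ![(b₂ * (a - y 0) - a₂ * (b - y 1)) / (L * D),
        (-b₁ * (a - y 0) + a₁ * (b - y 1)) / (L * D)] := ⟨_, rfl⟩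
    have ht0 : t 0 = (b₂ * (a - y 0) - a₂ * (b - y 1)) / (L * D) := by rw [htdef]; rfl
    have ht1 : t 1 = (-b₁ * (a - y 0) + a₁ * (b - y 1)) / (L * D) := by rw [htdef]; rfl
    have hTt : T ((a : ℂ), (b : ℂ)) = fun i => ((t i : ℝ) : ℂ) := by
      funext i
      revert i
      rw [Fin.forall_fin_two, hT0, hT1, ht0, ht1]
      constructor
      · push_cast; ring
      · push_cast; ring
    have htr : ∀ i, |t i| < r := by
      intro i
      have h := hTbound ((a : ℂ), (b : ℂ)) (by
          show ‖(a : ℂ) - (y 0 : ℝ)‖ < c * ‖y‖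
          rw [← Complex.ofReal_sub, Complex.norm_real, Real.norm_eq_abs]; exact ha) (by
          show ‖(b : ℂ) - (y 1 : ℝ)‖ < c * ‖y‖
          rw [← Complex.ofReal_sub, Complex.norm_real, Real.norm_eq_abs]; exact hb) i
      rw [hTt] at h
      simpa [Complex.norm_real] using h
    show G (T ((a : ℂ), (b : ℂ))) = k (mk2 a b)
    rw [hTt, hGr t htr]
    congr 2
    refine ext2 ?_ ?_
    · rw [lincomb_apply, mk2_zero, mk2_zero, mk2_zero, ht0, ht1, ← hL]
      field_simp
      rw [hD]; ring
    · rw [lincomb_apply, mk2_one, mk2_one, mk2_one, ht0, ht1, ← hL]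
      field_simp
      rw [hD]; ring
  · -- the universal bound
    intro M hM w hw
    obtain ⟨h1, h2⟩ := hball w hw
    have hz₀M : |k z₀| ≤ M := hM z₀ (by nlinarith)
    exact (hGM (T w) (hTbound w h1 h2)).trans hz₀M

/-! ## The rung -/

/-- **RUNG R1⁺ (by name): `PlanarConicChart`.** -/
theorem planarConicChart : PlanarConicChart := by
  intro k hk
  obtain ⟨r, hr, hcross⟩ :=
    Literature.Analysis.Complex.exists_holomorphic_extension_of_separately_local_fintype (ι := Fin 2) 1 one_pos
  have h3 : Real.sqrt 3 ^ 2 = 3 := sqrt3_sq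
  have hs3 : 0 < Real.sqrt 3 := Real.sqrt_pos.2 (by norm_num)
  -- the universal constant
  refine ⟨min (1 / 4) (r * Real.sqrt 3 / 48), lt_min (by norm_num) (by positivity), fun y hy => ?_⟩
  have hc4 : min (1 / 4) (r * Real.sqrt 3 / 48) ≤ 1 / 4 := min_le_left _ _
  have hcpos : 0 < min (1 / 4) (r * Real.sqrt 3 / 48) := lt_min (by norm_num) (by positivity)
  have hcr : ∀ D : ℝ, |D| = Real.sqrt 3 / 2 → 24 * min (1 / 4) (r * Real.sqrt 3 / 48) ≤ r * |D| := by
    intro D hDabs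
    rw [hDabs]
    have := min_le_right (1 / 4 : ℝ) (r * Real.sqrt 3 / 48)
    linarith
  -- frame data
  have hnE : (1 : ℝ) ^ 2 + (0 : ℝ) ^ 2 = 1 := by norm_num
  have hnP : (1 / 2 : ℝ) ^ 2 + (Real.sqrt 3 / 2) ^ 2 = 1 := by nlinarith
  have hnM : (1 / 2 : ℝ) ^ 2 + (-(Real.sqrt 3 / 2)) ^ 2 = 1 := by nlinarith
  have hτE : ∀ q : E2, q 0 = 1 * q 0 + 0 * q 1 := fun q => by ring
  have hτP : ∀ q : E2, q 0 / 2 + Real.sqrt 3 / 2 * q 1 = 1 / 2 * q 0 + Real.sqrt 3 / 2 * q 1 := fun q => by ring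
  have hτM : ∀ q : E2, q 0 / 2 - Real.sqrt 3 / 2 * q 1 = 1 / 2 * q 0 + -(Real.sqrt 3 / 2) * q 1 := fun q => by ring
  have hdEP : |(1 : ℝ) * (Real.sqrt 3 / 2) - 1 / 2 * 0| = Real.sqrt 3 / 2 := by
    rw [mul_zero, sub_zero, one_mul, abs_of_pos (by positivity)]
  have hdEM : |(1 : ℝ) * -(Real.sqrt 3 / 2) - 1 / 2 * 0| = Real.sqrt 3 / 2 := by
    rw [mul_zero, sub_zero, one_mul, abs_neg, abs_of_pos (by positivity)]
  have hdPM : |(1 / 2 : ℝ) * -(Real.sqrt 3 / 2) - 1 / 2 * (Real.sqrt 3 / 2)| = Real.sqrt 3 / 2 := by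
    rw [show (1 / 2 : ℝ) * -(Real.sqrt 3 / 2) - 1 / 2 * (Real.sqrt 3 / 2) = -(Real.sqrt 3 / 2) by ring, abs_neg,
      abs_of_pos (by positivity)]
  have hne : ∀ D : ℝ, |D| = Real.sqrt 3 / 2 → D ≠ 0 := fun D hD h0 => by
    rw [h0, abs_zero] at hD; linarith
  rcases exists_good_pair y with ⟨h1, h2⟩ | ⟨h1, h2⟩ | ⟨h1, h2⟩
  · exact conicChart_of_framePair hk hy (fun q => q 0) (fun q => q 0 / 2 + Real.sqrt 3 / 2 * q 1) 1 0 (1 / 2) (Real.sqrt 3 / 2)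
      hnE hnP hτE hτP (hne _ hdEP) (by norm_num) h1 h2 (frameHolomorphy_zero hk) (frameHolomorphy_pos hk)
      hcpos hc4 (hcr _ hdEP) hcross
  · exact conicChart_of_framePair hk hy (fun q => q 0) (fun q => q 0 / 2 - Real.sqrt 3 / 2 * q 1) 1 0 (1 / 2) (-(Real.sqrt 3 / 2))
      hnE hnM hτE hτM (hne _ hdEM) (by norm_num) h1 h2 (frameHolomorphy_zero hk) (frameHolomorphy_neg hk)
      hcpos hc4 (hcr _ hdEM) hcross
  · exact conicChart_of_framePair hk hy (fun q => q 0 / 2 + Real.sqrt 3 / 2 * q 1) (fun q => q 0 / 2 - Real.sqrt 3 / 2 * q 1)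
      (1 / 2) (Real.sqrt 3 / 2) (1 / 2) (-(Real.sqrt 3 / 2)) hnP hnM hτP hτM (hne _ hdPM)
      (by rw [show (1 / 2 : ℝ) * (1 / 2) + Real.sqrt 3 / 2 * -(Real.sqrt 3 / 2) = -(1 / 2) by nlinarith]; norm_num) h1 h2
      (frameHolomorphy_pos hk) (frameHolomorphy_neg hk) hcpos hc4 (hcr _ hdPM) hcross

end Summit.QuantumFields.YangMills.Theorems.F4SubCurvatureDoorPlanarConicChartRegistered

end
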